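import Summits.CriticalPhenomena.PercolationContinuityZ3.Theorems.Transplant.SkelFrmFromBParamsFaceOriginsYA
import Summits.CriticalPhenomena.PercolationContinuityZ3.Theorems.Transplant.SkelFrmBParamsFaceOriginsYA
import Summits.CriticalPhenomena.PercolationContinuityZ3.Theorems.Transplant.PlanarSkeletonFrmFromDefs
import Summits.CriticalPhenomena.PercolationContinuityZ3.Theorems.Transplant.PlanarSkeletonFrmDefs
import Summits.CriticalPhenomena.PercolationContinuityZ3.Theorems.Transplant.SkelPhiStepIDataNS
import HarnessLib
import Summits.CriticalPhenomena.PercolationContinuityZ3.Theorems.Transplant.SkelFrmBParamsFaceOriginsYQA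
/-!
# U-WAVE PORT (RULING D-U, lead g21 2026-08-26; WAVE-U-MANIFEST v3.1 row «SkelFrmBParamsFaceOriginsYQA» ↦ «SkelFrmFromBParamsFaceOriginsYQA») of the tree module
# `Transplant/SkelFrmBParamsFaceOriginsYQA` onto the carrier `PlanarSkeletonFrmFrom` (frames only, cylinders connected from width `ℓ₀` on)

ORIGINAL TITLE: (F) VALUE LAYER, N2 twin (hp-8 g42, 2026-08-23; F-DISCHARGE-MAP-N2 G18 y′-face origin READINGS `he_yLF?` + start half-widths): `port_frm.py` text of N1

builds on p205010 (kernel theorem, internal audit signed; external expert review pending) — nothing in this file uses p205010; NOTHING is claimed about the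
OPEN node U `SamePDropOfSkeletonFrmFrom₁` (nor U_s / the end state).  Lane `prim-bschramm`, seat `prim-bschramm-stmt` gen 26 (port pen, RULING M-11 family P-stmt; tool = p3-g26's port_u.py of record, registry-driven inputs); helper file
(`--supports stmt-CriticalPhenomena-4575 --as helper`).  PORT RULES r1–r4 of RULING D-U: declaration order and proof texts are those of the original,
byte-identical except (i) the carrier token `PlanarSkeletonFrm ↦ PlanarSkeletonFrmFrom` (binders, `namespace`/`end` lines, qualified names of twinned
declarations), (ii) carrier-FREE declarations of the original (φ-level `Skelφ…` blocks and namespace-only arithmetic residents) are NOT re-declared —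
this file imports the original and `export`s the twin-free residents (POLICY T / treatment (m1)); residents whose statement mentions a twinned
constant are copied, (iii) every carrier-binding declaration keeps its explicit binder `(Φ : PlanarSkeletonFrmFrom G)` in its own signature (r2).  Docstrings and citations are the original's.
-/

noncomputable section

open scoped Classical

namespace Summit.CriticalPhenomena.PercolationContinuityZ3.Theorems.Transplant

namespace PlanarSkeletonFrmFrom

namespace NegB

open Literature.Probability.Percolation Literature.Probability.LatticeModels SimpleGraph
open SkelConc (Consts)
open Skelφ (shearUnit shearUnit_pos sgnz sgnz_cases)
open Skelφ.StepI (DataN)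
open TwoAxis.Para (modulus)
open Neg

namespace KS

/-! ## §3 The readings the M3 y′ groups consume (`he0`, `he1`, `hΛ₁`) -/

section Readings

/-- From the functional sizes to the readings: `|Λ₀ y| ≤ 5m`, `|Λ₁ y| ≤ 2m` ⇒ `|FcA y| ≤ 6·u₀A`, `|F1cA y| ≤ 6·u₁A`, `|Λ₁ y| ≤ 3m`. [folklore] -/
theorem he_of_Λ (κ : Consts) {V : Type} [DecidableEq V] [Countable V] {G : SimpleGraph V} [G.LocallyFinite] (Φ : PlanarSkeletonFrmFrom G) (t : V) (p : unitInterval) (D : Skelφ.StepI.DataNS V) (f : ℕ) (g : ℕ) (hN : EqNumL κ Φ t p D g f) (y : Site 2)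
    (h : |Λ₀of κ Φ t p D g f y| ≤ 5 * modulus (nL κ Φ t p D g f) (hL κ Φ t p D g f) (vL κ Φ t p D g f) (vβL κ Φ t p D g f) ∧
      |Λ₁of κ Φ t p D g f y| ≤ 2 * modulus (nL κ Φ t p D g f) (hL κ Φ t p D g f) (vL κ Φ t p D g f) (vβL κ Φ t p D g f)) :
    |FcA κ Φ t p D g f y| ≤ 6 * u₀A κ Φ t p D g f ∧ |F1cA κ Φ t p D g f y| ≤ 6 * u₁A κ Φ t p D g f ∧
      |Λ₁of κ Φ t p D g f y| ≤ 3 * modulus (nL κ Φ t p D g f) (hL κ Φ t p D g f) (vL κ Φ t p D g f) (vβL κ Φ t p D g f) := by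
  obtain ⟨hn1, hℓ1⟩ := one_le_of_eqNumL κ Φ t p D g f hN
  have hm : 0 < modulus (nL κ Φ t p D g f) (hL κ Φ t p D g f) (vL κ Φ t p D g f) (vβL κ Φ t p D g f) := Skelφ.NegPrm.modulus_vβOf_pos hn1 hℓ1 _ _
  have hu0 : 1 ≤ u₀A κ Φ t p D g f := (units_eqA κ Φ t p D g f).2.2.2.2.1
  have hu1 : 1 ≤ u₁A κ Φ t p D g f := (units_eqA κ Φ t p D g f).2.2.2.2.2
  have h0 := abs_FcA_le_of_Λ₀ κ Φ t p D g f hN y h.1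
  have h1 := abs_F1cA_le_of_Λ₁ κ Φ t p D g f hN y h.2
  exact ⟨by linarith, by linarith, by linarith [h.2]⟩

/-- **READINGS AT `yLFs`**: `|FcA| ≤ 6u₀A`, `|F1cA| ≤ 6u₁A`, `|Λ₁| ≤ 3m`. [folklore] -/
theorem he_yLFs (κ : Consts) {V : Type} [DecidableEq V] [Countable V] {G : SimpleGraph V} [G.LocallyFinite] (Φ : PlanarSkeletonFrmFrom G) (t : V) (p : unitInterval) (D : Skelφ.StepI.DataNS V) (c : ℕ) (mk : ℕ) (gx : Neg.FSlot) (f : ℕ) (hN : EqNumL κ Φ t p D (gT mk gx κ Φ t p D) f) (hκ : (hL κ Φ t p D (gT mk gx κ Φ t p D) f).natAbs ≤ 10 * nL κ Φ t p D (gT mk gx κ Φ t p D) f)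
    (hS : 16 * SF κ Φ t p D c mk ≤ ML κ Φ t p D (gT mk gx κ Φ t p D)) (hMR0 : 22000 * (KS0.R'0 κ Φ t p D mk + 2) ≤ ML κ Φ t p D (gT mk gx κ Φ t p D)) {σ σh : ℤ} (hσ : σ = 1 ∨ σ = -1) (hσh : σh = 1 ∨ σh = -1) :
    |FcA κ Φ t p D (gT mk gx κ Φ t p D) f (yLFs κ Φ t p D c mk (gT mk gx κ Φ t p D) f σ σh)| ≤ 6 * u₀A κ Φ t p D (gT mk gx κ Φ t p D) f ∧
      |F1cA κ Φ t p D (gT mk gx κ Φ t p D) f (yLFs κ Φ t p D c mk (gT mk gx κ Φ t p D) f σ σh)| ≤ 6 * u₁A κ Φ t p D (gT mk gx κ Φ t p D) f ∧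
      |Λ₁of κ Φ t p D (gT mk gx κ Φ t p D) f (yLFs κ Φ t p D c mk (gT mk gx κ Φ t p D) f σ σh)| ≤
        3 * modulus (nL κ Φ t p D (gT mk gx κ Φ t p D) f) (hL κ Φ t p D (gT mk gx κ Φ t p D) f) (vL κ Φ t p D (gT mk gx κ Φ t p D) f) (vβL κ Φ t p D (gT mk gx κ Φ t p D) f) :=
  he_of_Λ κ Φ t p D f _ hN _ (Λ_yLFs κ Φ t p D c mk gx f hN hκ hS hMR0 hσ hσh)

/-- **READINGS AT `yLFd`**: `|FcA| ≤ 6u₀A`, `|F1cA| ≤ 6u₁A`, `|Λ₁| ≤ 3m`. [folklore] -/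
theorem he_yLFd (κ : Consts) {V : Type} [DecidableEq V] [Countable V] {G : SimpleGraph V} [G.LocallyFinite] (Φ : PlanarSkeletonFrmFrom G) (t : V) (p : unitInterval) (D : Skelφ.StepI.DataNS V) (c : ℕ) (mk : ℕ) (gx : Neg.FSlot) (f : ℕ) (hN : EqNumL κ Φ t p D (gT mk gx κ Φ t p D) f) (hκ : (hL κ Φ t p D (gT mk gx κ Φ t p D) f).natAbs ≤ 10 * nL κ Φ t p D (gT mk gx κ Φ t p D) f)
    (hS : 16 * SF κ Φ t p D c mk ≤ ML κ Φ t p D (gT mk gx κ Φ t p D)) (hMR0 : 22000 * (KS0.R'0 κ Φ t p D mk + 2) ≤ ML κ Φ t p D (gT mk gx κ Φ t p D)) {σ σh : ℤ} (hσ : σ = 1 ∨ σ = -1) (hσh : σh = 1 ∨ σh = -1) :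
    |FcA κ Φ t p D (gT mk gx κ Φ t p D) f (yLFd κ Φ t p D c mk (gT mk gx κ Φ t p D) f σ σh)| ≤ 6 * u₀A κ Φ t p D (gT mk gx κ Φ t p D) f ∧
      |F1cA κ Φ t p D (gT mk gx κ Φ t p D) f (yLFd κ Φ t p D c mk (gT mk gx κ Φ t p D) f σ σh)| ≤ 6 * u₁A κ Φ t p D (gT mk gx κ Φ t p D) f ∧
      |Λ₁of κ Φ t p D (gT mk gx κ Φ t p D) f (yLFd κ Φ t p D c mk (gT mk gx κ Φ t p D) f σ σh)| ≤
        3 * modulus (nL κ Φ t p D (gT mk gx κ Φ t p D) f) (hL κ Φ t p D (gT mk gx κ Φ t p D) f) (vL κ Φ t p D (gT mk gx κ Φ t p D) f) (vβL κ Φ t p D (gT mk gx κ Φ t p D) f) :=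
  he_of_Λ κ Φ t p D f _ hN _ (Λ_yLFd κ Φ t p D c mk gx f hN hκ hS hMR0 hσ hσh)

/-- **READINGS AT `yLFt`**: `|FcA| ≤ 6u₀A`, `|F1cA| ≤ 6u₁A`, `|Λ₁| ≤ 3m`. [folklore] -/
theorem he_yLFt (κ : Consts) {V : Type} [DecidableEq V] [Countable V] {G : SimpleGraph V} [G.LocallyFinite] (Φ : PlanarSkeletonFrmFrom G) (t : V) (p : unitInterval) (D : Skelφ.StepI.DataNS V) (c : ℕ) (mk : ℕ) (gx : Neg.FSlot) (f : ℕ) (hN : EqNumL κ Φ t p D (gT mk gx κ Φ t p D) f) (hκ : (hL κ Φ t p D (gT mk gx κ Φ t p D) f).natAbs ≤ 10 * nL κ Φ t p D (gT mk gx κ Φ t p D) f)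
    (hS : 16 * SF κ Φ t p D c mk ≤ ML κ Φ t p D (gT mk gx κ Φ t p D)) (hMR0 : 22000 * (KS0.R'0 κ Φ t p D mk + 2) ≤ ML κ Φ t p D (gT mk gx κ Φ t p D)) {σ σh : ℤ} (hσ : σ = 1 ∨ σ = -1) (hσh : σh = 1 ∨ σh = -1) :
    |FcA κ Φ t p D (gT mk gx κ Φ t p D) f (yLFt κ Φ t p D c mk (gT mk gx κ Φ t p D) f σ σh)| ≤ 6 * u₀A κ Φ t p D (gT mk gx κ Φ t p D) f ∧
      |F1cA κ Φ t p D (gT mk gx κ Φ t p D) f (yLFt κ Φ t p D c mk (gT mk gx κ Φ t p D) f σ σh)| ≤ 6 * u₁A κ Φ t p D (gT mk gx κ Φ t p D) f ∧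
      |Λ₁of κ Φ t p D (gT mk gx κ Φ t p D) f (yLFt κ Φ t p D c mk (gT mk gx κ Φ t p D) f σ σh)| ≤
        3 * modulus (nL κ Φ t p D (gT mk gx κ Φ t p D) f) (hL κ Φ t p D (gT mk gx κ Φ t p D) f) (vL κ Φ t p D (gT mk gx κ Φ t p D) f) (vβL κ Φ t p D (gT mk gx κ Φ t p D) f) :=
  he_of_Λ κ Φ t p D f _ hN _ (Λ_yLFt κ Φ t p D c mk gx f hN hκ hS hMR0 hσ hσh)

end Readings

/-! ## §4 The start half-height's budgets at `qB′ := qBF` -/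

section Budgets

/-- `U·qBF ≤ n_L·q⋆F + |h_L|·w⋆F + n_L + U` (`qBF = ⌊X/U⌋ + 1`). [folklore] -/
theorem U_qBF_le (κ : Consts) {V : Type} [DecidableEq V] [Countable V] {G : SimpleGraph V} [G.LocallyFinite] (Φ : PlanarSkeletonFrmFrom G) (t : V) (p : unitInterval) (D : Skelφ.StepI.DataNS V) (c : ℕ) (mk : ℕ) (g : ℕ) (f : ℕ) (hN : EqNumL κ Φ t p D g f) :
    (shearUnit (nL κ Φ t p D g f) (hL κ Φ t p D g f) : ℤ) * (qBF κ Φ t p D c mk g f : ℤ) ≤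
      (nL κ Φ t p D g f : ℤ) * (qStarF κ Φ t p D c mk g f : ℤ) + |hL κ Φ t p D g f| * (wStarF κ Φ t p D c mk : ℤ) + nL κ Φ t p D g f +
        shearUnit (nL κ Φ t p D g f) (hL κ Φ t p D g f) := by
  obtain ⟨hn1, -⟩ := one_le_of_eqNumL κ Φ t p D g f hN
  set U := shearUnit (nL κ Φ t p D g f) (hL κ Φ t p D g f) with hU
  set X := nL κ Φ t p D g f * qStarF κ Φ t p D c mk g f + (hL κ Φ t p D g f).natAbs * wStarF κ Φ t p D c mk + nL κ Φ t p D g f with hX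
  have h1 : X / U * U ≤ X := Nat.div_mul_le_self X U
  have h2 : qBF κ Φ t p D c mk g f * U ≤ X + U := by
    unfold qBF; rw [← hX, ← hU, Nat.add_mul, one_mul]; omega
  have h3 : ((qBF κ Φ t p D c mk g f * U : ℕ) : ℤ) ≤ ((X + U : ℕ) : ℤ) := by exact_mod_cast h2
  have e : ((X : ℕ) : ℤ) = (nL κ Φ t p D g f : ℤ) * (qStarF κ Φ t p D c mk g f : ℤ) + |hL κ Φ t p D g f| * (wStarF κ Φ t p D c mk : ℤ) + nL κ Φ t p D g f := by
    rw [hX]; push_cast [Int.natCast_natAbs]; ring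
  push_cast at h3; rw [e] at h3; linarith

/-- **hp-8's `hqB2` at `qB′ := qBF`**: `2·(U·qBF) ≤ n_Lℓ_L + n_L·(21·S_F + 22·RA′ + 130)` (`|h_L| ≤ 10 n_L`, `n_BF ≥ 27`). [folklore] -/
theorem two_U_qBF_le (κ : Consts) {V : Type} [DecidableEq V] [Countable V] {G : SimpleGraph V} [G.LocallyFinite] (Φ : PlanarSkeletonFrmFrom G) (t : V) (p : unitInterval) (D : Skelφ.StepI.DataNS V) (c : ℕ) (mk : ℕ) (g : ℕ) (f : ℕ) (hN : EqNumL κ Φ t p D g f) (hκ : (hL κ Φ t p D g f).natAbs ≤ 10 * nL κ Φ t p D g f) :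
    2 * ((shearUnit (nL κ Φ t p D g f) (hL κ Φ t p D g f) : ℤ) * (qBF κ Φ t p D c mk g f : ℤ)) ≤
      (nL κ Φ t p D g f : ℤ) * ℓL κ Φ t p D g f +
        (nL κ Φ t p D g f : ℤ) * (21 * ((SF κ Φ t p D c mk : ℕ) : ℤ) + 22 * (KS0.R'0 κ Φ t p D mk : ℤ) + 130) := by
  obtain ⟨hn1, -⟩ := one_le_of_eqNumL κ Φ t p D g f hN
  have h0 := U_qBF_le κ Φ t p D c mk g f hN
  have hκ' : |hL κ Φ t p D g f| ≤ 10 * (nL κ Φ t p D g f : ℤ) := by rw [← Int.natCast_natAbs]; exact_mod_cast hκ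
  have hUe : (shearUnit (nL κ Φ t p D g f) (hL κ Φ t p D g f) : ℤ) = (nL κ Φ t p D g f : ℤ) + |hL κ Φ t p D g f| := by
    unfold Skelφ.shearUnit; push_cast [Int.natCast_natAbs]; ring
  have hSe := SF_int κ Φ t p D c mk
  obtain ⟨a1, -⟩ := PlanarSkeletonNeg.NegB.RootArith.floor_sandwich (x := (ℓL κ Φ t p D g f : ℤ)) (d := 2) (by norm_num)
  obtain ⟨b1, -⟩ := PlanarSkeletonNeg.NegB.RootArith.floor_sandwich (x := (ℓBF κ Φ t p D c mk : ℤ)) (d := 2) (by norm_num)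
  have hq : 2 * (qStarF κ Φ t p D c mk g f : ℤ) ≤ (ℓL κ Φ t p D g f : ℤ) + ℓBF κ Φ t p D c mk + 2 * nBF κ Φ t p D c mk + 2 * KS0.R'0 κ Φ t p D mk + 4 := by
    unfold qStarF; push_cast; linarith
  have hw : 2 * (wStarF κ Φ t p D c mk : ℤ) ≤ 2 * (KS0.R'0 κ Φ t p D mk : ℤ) + ℓBF κ Φ t p D c mk + 2 * |hBF κ Φ t p D c mk| + 12 := by
    unfold wStarF; push_cast [Int.natCast_natAbs]; linarith
  have hw0 : (0 : ℤ) ≤ (wStarF κ Φ t p D c mk : ℤ) := by positivity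
  have hnB : (27 : ℤ) ≤ (nBF κ Φ t p D c mk : ℤ) := by
    have h1 := (MBF_floors κ Φ t p D c mk).1; have h2 := (RF2F κ Φ t p D c mk).2.1
    have : 27 ≤ nBF κ Φ t p D c mk := by omega
    exact_mod_cast this
  have hh0 := abs_nonneg (hL κ Φ t p D g f)
  have hhB0 := abs_nonneg (hBF κ Φ t p D c mk)
  have hR0 : (0 : ℤ) ≤ (KS0.R'0 κ Φ t p D mk : ℤ) := by positivity
  have hℓB0 : (0 : ℤ) ≤ (ℓBF κ Φ t p D c mk : ℤ) := by positivity
  have hn0 : (0 : ℤ) ≤ (nL κ Φ t p D g f : ℤ) := by positivity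
  -- `|h|·(2w⋆) ≤ 10n·(2RA′ + ℓBF + 2|hBF| + 12)`, `n·(2q⋆) ≤ n·(ℓ + ℓBF + 2nBF + 2RA′ + 4)`
  have p1 : |hL κ Φ t p D g f| * (2 * (wStarF κ Φ t p D c mk : ℤ)) ≤ (10 * (nL κ Φ t p D g f : ℤ)) * (2 * (KS0.R'0 κ Φ t p D mk : ℤ) + ℓBF κ Φ t p D c mk + 2 * |hBF κ Φ t p D c mk| + 12) :=
    mul_le_mul hκ' hw (by positivity) (by positivity)
  have p2 : (nL κ Φ t p D g f : ℤ) * (2 * (qStarF κ Φ t p D c mk g f : ℤ)) ≤ (nL κ Φ t p D g f : ℤ) * ((ℓL κ Φ t p D g f : ℤ) + ℓBF κ Φ t p D c mk + 2 * nBF κ Φ t p D c mk + 2 * KS0.R'0 κ Φ t p D mk + 4) :=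
    mul_le_mul_of_nonneg_left hq hn0
  rw [hSe]; rw [hUe] at h0 ⊢
  nlinarith [p1, p2, h0, mul_nonneg hn0 hℓB0, mul_nonneg hn0 hhB0, mul_nonneg hn0 (by linarith : (0:ℤ) ≤ (nBF κ Φ t p D c mk : ℤ) - 27), mul_nonneg hh0 hw0]

/-- **stmt's `hqB` at `qB′ := qBF`**: `4·(U·qBF) ≤ 5·(n_Lℓ_L)` (floor `16·S_F ≤ M_L`, `M_L + 1 ≤ ℓ_L`, `22000·Kq·(RA′+2) ≤ ℓ_L`, `|h_L| ≤ 10n_L`). [folklore] -/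
theorem four_U_qBF_le (κ : Consts) {V : Type} [DecidableEq V] [Countable V] {G : SimpleGraph V} [G.LocallyFinite] (Φ : PlanarSkeletonFrmFrom G) (t : V) (p : unitInterval) (D : Skelφ.StepI.DataNS V) (c : ℕ) (mk : ℕ) (g : ℕ) (f : ℕ) (hN : EqNumL κ Φ t p D g f) (hκ : (hL κ Φ t p D g f).natAbs ≤ 10 * nL κ Φ t p D g f)
    (hS : 16 * SF κ Φ t p D c mk ≤ ML κ Φ t p D g) (hℓA : 22000 * Neg.Kq κ * (KS0.R'0 κ Φ t p D mk + 2) ≤ ℓL κ Φ t p D g f) :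
    4 * ((shearUnit (nL κ Φ t p D g f) (hL κ Φ t p D g f) : ℤ) * (qBF κ Φ t p D c mk g f : ℤ)) ≤ 5 * ((nL κ Φ t p D g f : ℤ) * ℓL κ Φ t p D g f) := by
  have h2 := two_U_qBF_le κ Φ t p D c mk g f hN hκ
  have hMℓ := hN.ℓ_le
  have hS16 : 16 * (((SF κ Φ t p D c mk : ℕ) : ℤ)) ≤ (ML κ Φ t p D g : ℤ) := by
    have h' : ((16 * SF κ Φ t p D c mk : ℕ) : ℤ) ≤ (ML κ Φ t p D g : ℤ) := by exact_mod_cast hS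
    simpa only [Nat.cast_mul, Nat.cast_ofNat] using h'
  have hℓ' : 22000 * (Neg.Kq κ : ℤ) * ((KS0.R'0 κ Φ t p D mk : ℤ) + 2) ≤ (ℓL κ Φ t p D g f : ℤ) := by exact_mod_cast hℓA
  have hKq : (1 : ℤ) ≤ (Neg.Kq κ : ℤ) := by exact_mod_cast Neg.one_le_Kq κ
  have hR0 : (0 : ℤ) ≤ (KS0.R'0 κ Φ t p D mk : ℤ) := by positivity
  have hn0 : (0 : ℤ) ≤ (nL κ Φ t p D g f : ℤ) := by positivity
  have hKR : (KS0.R'0 κ Φ t p D mk : ℤ) + 2 ≤ (Neg.Kq κ : ℤ) * ((KS0.R'0 κ Φ t p D mk : ℤ) + 2) := le_mul_of_one_le_left (by linarith) hKq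
  have key : 2 * (21 * ((SF κ Φ t p D c mk : ℕ) : ℤ) + 22 * (KS0.R'0 κ Φ t p D mk : ℤ) + 130) ≤ 3 * (ℓL κ Φ t p D g f : ℤ) := by nlinarith
  have := mul_le_mul_of_nonneg_left key hn0
  nlinarith

end Budgets

/-! ## §5 The origins' sizes `|yLF?|₁ ≤ YbF + U_L` -/

section Sizes

/-- **The size of a generic y′ origin**: `|yLFof 0| + |yLFof 1| ≤ |c₀| + |v′| + |b₁| + 2|h_L| + 1` whenever `|v′| ≤ 2n_L`. [folklore] -/
theorem l1_yLFof (κ : Consts) {V : Type} [DecidableEq V] [Countable V] {G : SimpleGraph V} [G.LocallyFinite] (Φ : PlanarSkeletonFrmFrom G) (t : V) (p : unitInterval) (D : Skelφ.StepI.DataNS V) (f : ℕ) (g : ℕ) (hN : EqNumL κ Φ t p D g f) {σ σh : ℤ} (hσh : σh = 1 ∨ σh = -1) (clo c₀ b₁ : ℤ)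
    (hv' : |clo + nL κ Φ t p D g f - c₀ + σ * σh * vL κ Φ t p D g f| ≤ 2 * (nL κ Φ t p D g f : ℤ)) :
    |yLFof κ Φ t p D g f σ σh clo c₀ b₁ 0| + |yLFof κ Φ t p D g f σ σh clo c₀ b₁ 1| ≤
      |c₀| + |clo + nL κ Φ t p D g f - c₀ + σ * σh * vL κ Φ t p D g f| + |b₁| + 2 * |hL κ Φ t p D g f| + 1 := by
  obtain ⟨hn1, -⟩ := one_le_of_eqNumL κ Φ t p D g f hN
  have hn0 : (0 : ℤ) < (nL κ Φ t p D g f : ℤ) := by exact_mod_cast hn1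
  obtain ⟨e0, e1⟩ := yLFof_eq κ Φ t p D g f hσh σ clo c₀ b₁
  have hσh' : |σh| = 1 := by rcases hσh with h | h <;> simp [h]
  set v' := clo + nL κ Φ t p D g f - c₀ + σ * σh * vL κ Φ t p D g f
  obtain ⟨f1, f2⟩ := PlanarSkeletonNeg.NegB.RootArith.floor_sandwich (x := σh * hL κ Φ t p D g f * v') hn0
  set q := σh * hL κ Φ t p D g f * v' / (nL κ Φ t p D g f : ℤ)
  -- `n|q| ≤ |h|·|v′| + n ≤ n(2|h| + 1)`
  have hX : |σh * hL κ Φ t p D g f * v'| ≤ |hL κ Φ t p D g f| * (2 * (nL κ Φ t p D g f : ℤ)) := by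
    rw [abs_mul, abs_mul, hσh', one_mul]; exact mul_le_mul_of_nonneg_left hv' (abs_nonneg _)
  have hq : (nL κ Φ t p D g f : ℤ) * |q| ≤ (nL κ Φ t p D g f : ℤ) * (2 * |hL κ Φ t p D g f| + 1) := by
    rw [← abs_of_pos hn0, ← abs_mul, abs_of_pos hn0]
    have := abs_le.1 hX
    rw [abs_le]; constructor <;> nlinarith [this.1, this.2, abs_nonneg (hL κ Φ t p D g f)]
  have hq' : |q| ≤ 2 * |hL κ Φ t p D g f| + 1 := le_of_mul_le_mul_left hq hn0
  rw [e0, e1]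
  calc |σh * (c₀ + v')| + |b₁ + q| ≤ (|c₀| + |v'|) + (|b₁| + |q|) := by
        rw [abs_mul, hσh', one_mul]; exact add_le_add (abs_add_le _ _) (abs_add_le _ _)
    _ ≤ |c₀| + |v'| + |b₁| + 2 * |hL κ Φ t p D g f| + 1 := by linarith

/-- **`|yLFs|₁ ≤ YbF + U_L`** (case same; floor `16·S_F ≤ M_L` at `g := gT`). [folklore] -/
theorem l1_yLFs (κ : Consts) {V : Type} [DecidableEq V] [Countable V] {G : SimpleGraph V} [G.LocallyFinite] (Φ : PlanarSkeletonFrmFrom G) (t : V) (p : unitInterval) (D : Skelφ.StepI.DataNS V) (c : ℕ) (mk : ℕ) (gx : Neg.FSlot) (f : ℕ) (hN : EqNumL κ Φ t p D (gT mk gx κ Φ t p D) f) (hκ : (hL κ Φ t p D (gT mk gx κ Φ t p D) f).natAbs ≤ 10 * nL κ Φ t p D (gT mk gx κ Φ t p D) f)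
    (hS : 16 * SF κ Φ t p D c mk ≤ ML κ Φ t p D (gT mk gx κ Φ t p D)) (hMR0 : 22000 * (KS0.R'0 κ Φ t p D mk + 2) ≤ ML κ Φ t p D (gT mk gx κ Φ t p D)) {σ σh : ℤ} (hσ : σ = 1 ∨ σ = -1) (hσh : σh = 1 ∨ σh = -1) :
    (yLFs κ Φ t p D c mk (gT mk gx κ Φ t p D) f σ σh 0).natAbs + (yLFs κ Φ t p D c mk (gT mk gx κ Φ t p D) f σ σh 1).natAbs ≤
      YbF κ Φ t p D c mk (gT mk gx κ Φ t p D) f + shearUnit (nL κ Φ t p D (gT mk gx κ Φ t p D) f) (hL κ Φ t p D (gT mk gx κ Φ t p D) f) := by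
  rw [yLFs_eq_yLFof]
  obtain ⟨hn1, hℓ1⟩ := one_le_of_eqNumL κ Φ t p D _ f hN
  have hv : |vL κ Φ t p D (gT mk gx κ Φ t p D) f| ≤ nL κ Φ t p D (gT mk gx κ Φ t p D) f := hN.v_le
  have hκ' : |hL κ Φ t p D (gT mk gx κ Φ t p D) f| ≤ 10 * (nL κ Φ t p D (gT mk gx κ Φ t p D) f : ℤ) := by rw [← Int.natCast_natAbs]; exact_mod_cast hκ
  have hSe := SF_int κ Φ t p D c mk
  have hS16 : 16 * (((SF κ Φ t p D c mk : ℕ) : ℤ)) ≤ (ML κ Φ t p D (gT mk gx κ Φ t p D) : ℤ) := by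
    have h' : ((16 * SF κ Φ t p D c mk : ℕ) : ℤ) ≤ (ML κ Φ t p D (gT mk gx κ Φ t p D) : ℤ) := by exact_mod_cast hS
    simpa only [Nat.cast_mul, Nat.cast_ofNat] using h'
  have h22 := (show 22000 * ((KS0.R'0 κ Φ t p D mk : ℤ) + 2) ≤ (ML κ Φ t p D (gT mk gx κ Φ t p D) : ℤ) by exact_mod_cast hMR0)
  have hMn := hN.n_le
  have hMℓ := hN.ℓ_le
  have hR0 : (0 : ℤ) ≤ (KS0.R'0 κ Φ t p D mk : ℤ) := by positivity
  have hnB0 : (0 : ℤ) ≤ (nBF κ Φ t p D c mk : ℤ) := by positivity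
  have hℓB0 : (0 : ℤ) ≤ (ℓBF κ Φ t p D c mk : ℤ) := by positivity
  have hhB0 := abs_nonneg (hBF κ Φ t p D c mk)
  have hh0 := abs_nonneg (hL κ Φ t p D (gT mk gx κ Φ t p D) f)
  obtain ⟨f1, f2⟩ := PlanarSkeletonNeg.NegB.RootArith.floor_sandwich (x := (ℓL κ Φ t p D (gT mk gx κ Φ t p D) f : ℤ) + ℓBF κ Φ t p D c mk) (d := 2) (by norm_num)
  have hσ2 : |σ * σh| ≤ 1 := by rcases hσ with rfl | rfl <;> rcases hσh with rfl | rfl <;> norm_num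
  have hσh' : |σh| = 1 := by rcases hσh with h | h <;> simp [h]
  have hv' : |(nL κ Φ t p D (gT mk gx κ Φ t p D) f : ℤ) + nBF κ Φ t p D c mk - KS0.R'0 κ Φ t p D mk + nL κ Φ t p D (gT mk gx κ Φ t p D) f -
      ((nL κ Φ t p D (gT mk gx κ Φ t p D) f : ℤ) + nBF κ Φ t p D c mk) + σ * σh * vL κ Φ t p D (gT mk gx κ Φ t p D) f| ≤ 2 * (nL κ Φ t p D (gT mk gx κ Φ t p D) f : ℤ) := by
    have h1 : |σ * σh * vL κ Φ t p D (gT mk gx κ Φ t p D) f| ≤ nL κ Φ t p D (gT mk gx κ Φ t p D) f := by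
      rw [abs_mul]; nlinarith [abs_nonneg (vL κ Φ t p D (gT mk gx κ Φ t p D) f), abs_nonneg (σ * σh)]
    rw [abs_le] at h1 ⊢; constructor <;> linarith [h1.1, h1.2]
  have hl := l1_yLFof κ Φ t p D f _ hN hσh _ _ (σh * (hL κ Φ t p D (gT mk gx κ Φ t p D) f + hBF κ Φ t p D c mk) +
      ((ℓL κ Φ t p D (gT mk gx κ Φ t p D) f : ℤ) + ℓBF κ Φ t p D c mk) / 2) hv'
  have hb : |σh * (hL κ Φ t p D (gT mk gx κ Φ t p D) f + hBF κ Φ t p D c mk) + ((ℓL κ Φ t p D (gT mk gx κ Φ t p D) f : ℤ) + ℓBF κ Φ t p D c mk) / 2| ≤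
      |hL κ Φ t p D (gT mk gx κ Φ t p D) f| + |hBF κ Φ t p D c mk| + ((ℓL κ Φ t p D (gT mk gx κ Φ t p D) f : ℤ) + ℓBF κ Φ t p D c mk) / 2 := by
    calc _ ≤ |σh * (hL κ Φ t p D (gT mk gx κ Φ t p D) f + hBF κ Φ t p D c mk)| + |((ℓL κ Φ t p D (gT mk gx κ Φ t p D) f : ℤ) + ℓBF κ Φ t p D c mk) / 2| := abs_add_le _ _
      _ ≤ _ := by rw [abs_mul, hσh', one_mul, abs_of_nonneg (by omega : (0:ℤ) ≤ ((ℓL κ Φ t p D (gT mk gx κ Φ t p D) f : ℤ) + ℓBF κ Φ t p D c mk) / 2)]; linarith [abs_add_le (hL κ Φ t p D (gT mk gx κ Φ t p D) f) (hBF κ Φ t p D c mk)]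
  have hc : |(nL κ Φ t p D (gT mk gx κ Φ t p D) f : ℤ) + nBF κ Φ t p D c mk| ≤ (nL κ Φ t p D (gT mk gx κ Φ t p D) f : ℤ) + nBF κ Φ t p D c mk := by
    rw [abs_of_nonneg (by positivity)]
  have hY : (YbF κ Φ t p D c mk (gT mk gx κ Φ t p D) f : ℤ) = 2 * ((nL κ Φ t p D (gT mk gx κ Φ t p D) f : ℤ) + |hL κ Φ t p D (gT mk gx κ Φ t p D) f| +
      ℓL κ Φ t p D (gT mk gx κ Φ t p D) f + KS0.R'0 κ Φ t p D mk + ((SF κ Φ t p D c mk : ℕ) : ℤ) + 11) := by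
    unfold YbF; push_cast [Int.natCast_natAbs]; ring
  have hUe : (shearUnit (nL κ Φ t p D (gT mk gx κ Φ t p D) f) (hL κ Φ t p D (gT mk gx κ Φ t p D) f) : ℤ) = (nL κ Φ t p D (gT mk gx κ Φ t p D) f : ℤ) + |hL κ Φ t p D (gT mk gx κ Φ t p D) f| := by
    unfold Skelφ.shearUnit; push_cast [Int.natCast_natAbs]; ring
  rw [← Nat.cast_le (α := ℤ)]; push_cast [Int.natCast_natAbs]; rw [hY, hUe]
  rw [hSe] at hY ⊢
  linarith [hl, hb, hc, hv']

end Sizes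

end KS

end NegB

end PlanarSkeletonFrmFrom

end Summit.CriticalPhenomena.PercolationContinuityZ3.Theorems.Transplant

end
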